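import Mathlib
import Literature.AlgebraicGeometry.Resolution.CobordantGame
import Literature.AlgebraicGeometry.Resolution.CobordantChartCoefficients
import Literature.AlgebraicGeometry.Resolution.AxisPolyhedron
import Literature.AlgebraicGeometry.Resolution.FormalCoordinateChange
import Summits.ResolutionOfSingularities.ResolutionOfSingularities.Theorems.WeightedInvariantLocalWeightedDropApexFreeOrderDrop
import Summits.ResolutionOfSingularities.ResolutionOfSingularities.Theorems.WeightedInvariantLocalWeightedDropConeDichotomyAux
import Summits.ResolutionOfSingularities.ResolutionOfSingularities.Theorems.WeightedInvariantLocalWeightedDropTschirnhausFormAux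

/-!
# `WeightedInvariant.LocalWeightedDrop`, line `hasse-ridge-face-selection`: axis normalisation

Crux item stmt-ResolutionOfSingularities-8899 (route `ResolutionOfSingularities/WeightedInvariant`),
skeleton v18 of the line `hasse-ridge-face-selection`, stub `stub_axisNormalize` (B5), PROVED here
(statement verbatim from the ledger registration).

**Statement (linear algebra over an algebraically closed, hence infinite, field).**  Let
`f ∈ k[[x₁, …, x_{n+3}]]` have order `d ≥ 3` and let `P = in_d f` be its degree-`d` form, read as the
function `P(v) = CobordantChart.initEval 1 v d f`.  If `P` has a non-zero translation-invariance vector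
`c` (`P(v + c) = P(v)` for all `v`) and any two invariance vectors are linearly dependent (apex of dimension
exactly one), then after an invertible LINEAR change `θ = (x ↦ M x)` with last column `c` the germ `f ∘ θ`
has order `d`, its degree-`d` form involves no `z = x_{n+3}` (`AxisPolyhedron.AxisCone`) and has trivial
apex inside `z = 0` (`AxisPolyhedron.TrivialApexX`).

**Proof.**
1. MATRIX: pick `l` with `c_l ≠ 0`, `σ = swap l z`; `M = U.submatrix σ id` for `U` the identity with last
   column `c ∘ σ` has `det M = sign σ · c_l ≠ 0` and last column `c`.
2. `in_d (f ∘ θ)(v) = in_d f (M v)` (`initEval_subst_linSubst`): both sides are the `y^d`-coefficient of the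
   diagonal restriction `x ↦ (w_i y)_i` (`TschirnhausForm.coeff_single_subst_smul_X`), and restricting
   `f ∘ θ` to the line through `v` is restricting `f` to the line through `M v`.
3. HOMOGENEITY (`initEval_smul`): `P(t v) = t^d P(v)`, so invariance by `c` gives invariance by every `t c`
   (`initEval_add_smul`); hence `Q = in_d (f ∘ θ)` satisfies `Q(v + t e_z) = Q(v)`.
4. AXIS CONE: a polynomial `Q` over an infinite field whose function does not depend on the last coordinate
   has no monomial involving `X_z` (`coeff_eq_zero_of_eval_indep`: `Q = Q(x', 0)` by `MvPolynomial.funext`,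
   and `z ∉ vars Q(x', 0)` by `MvPolynomial.vars_bind₁`); apply it to the initial form of `f ∘ θ`
   (`ApexFreeOrderDrop.eval_initForm`, `coeff_initForm`).
5. TRIVIAL APEX: an invariance vector `ũ = (u, 0)` of `Q` on `z = 0` is one everywhere (by 3), so `M ũ` is an
   invariance vector of `P` (by 2, `M` onto), collinear with `c = M e_z`; cancelling `M` gives
   `α e_z + β ũ = 0`, whence `α = 0`, `β ≠ 0`, `u = 0`.
6. ORDER: substitutions do not lower the order, and `θ` has the inverse `x ↦ M⁻¹ x`.
-/

set_option linter.dupNamespace false -- mandated namespace of this single-conjunct summit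

namespace Summit.ResolutionOfSingularities.ResolutionOfSingularities.Theorems

open Literature.AlgebraicGeometry.Resolution

namespace AxisNormalize

open MvPowerSeries

variable {k : Type} [Field k] {N : ℕ}

/-! ### The degree-`d` form as a function: homogeneity and linear substitutions -/

/-- HOMOGENEITY of the evaluated degree-`d` form: `in_d F (t • v) = t ^ d · in_d F (v)`. -/
theorem initEval_smul (t : k) (v : Fin N → k) (d : ℕ) (F : MvPowerSeries (Fin N) k) :
    CobordantChart.initEval (fun _ : Fin N => 1) (t • v) d F =
      t ^ d * CobordantChart.initEval (fun _ : Fin N => 1) v d F := by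
  rw [ApexFreeOrderDrop.initEval_one_eq_sum, ApexFreeOrderDrop.initEval_one_eq_sum, Finset.mul_sum]
  refine Finset.sum_congr rfl fun e he => ?_
  have hd : ∑ i, e i = d := (Finset.mem_finsuppAntidiag.mp he).1
  simp_rw [Pi.smul_apply, smul_eq_mul, mul_pow, Finset.prod_mul_distrib, Finset.prod_pow_eq_pow_sum, hd]
  ring

/-- Translation invariance of the degree-`d` form by `c` propagates to the line `k • c` (homogeneity). -/
theorem initEval_add_smul {d : ℕ} {F : MvPowerSeries (Fin N) k} {c : Fin N → k}
    (hc : ∀ v : Fin N → k, CobordantChart.initEval (fun _ : Fin N => 1) (v + c) d F =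
      CobordantChart.initEval (fun _ : Fin N => 1) v d F)
    (v : Fin N → k) (t : k) :
    CobordantChart.initEval (fun _ : Fin N => 1) (v + t • c) d F =
      CobordantChart.initEval (fun _ : Fin N => 1) v d F := by
  by_cases ht : t = 0
  · rw [ht, zero_smul, add_zero]
  · have hv : v + t • c = t • (t⁻¹ • v + c) := by
      rw [smul_add, smul_smul, mul_inv_cancel₀ ht, one_smul]
    rw [hv, initEval_smul, hc, ← initEval_smul, smul_smul, mul_inv_cancel₀ ht, one_smul]

/-- The evaluated degree-`d` form `in_d G (v)` is the `X_l^d`-coefficient of the diagonal restriction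
`x_i ↦ v_i X_l` (`TschirnhausForm.coeff_single_subst_smul_X`). -/
theorem initEval_eq_coeff_subst_smul_X (l : Fin N) (v : Fin N → k) (d : ℕ) (G : MvPowerSeries (Fin N) k) :
    CobordantChart.initEval (fun _ : Fin N => 1) v d G =
      coeff (Finsupp.single l d) (subst (fun i => v i • (X l : MvPowerSeries (Fin N) k)) G) := by
  rw [TschirnhausForm.coeff_single_subst_smul_X, ApexFreeOrderDrop.initEval_one_eq_sum]
  refine Finset.sum_congr rfl fun α _ => ?_
  rw [Finsupp.prod_pow]

/-- LINEAR SUBSTITUTIONS COMPOSE INTO THE DEGREE-`d` FORM: `in_d (F ∘ (x ↦ M x)) (v) = in_d F (M v)`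
(`l` is any auxiliary index). -/
theorem initEval_subst_linSubst (l : Fin N) (M : Matrix (Fin N) (Fin N) k) (v : Fin N → k) (d : ℕ)
    (F : MvPowerSeries (Fin N) k) :
    CobordantChart.initEval (fun _ : Fin N => 1) v d (subst (FormalCoordChange.linSubst M) F) =
      CobordantChart.initEval (fun _ : Fin N => 1) (M.mulVec v) d F := by
  have h0 : ∀ w : Fin N → k, HasSubst (fun i => w i • (X l : MvPowerSeries (Fin N) k)) := fun w =>
    hasSubst_of_constantCoeff_zero fun i => by rw [smul_eq_C_mul, map_mul, constantCoeff_X, mul_zero]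
  rw [initEval_eq_coeff_subst_smul_X l, initEval_eq_coeff_subst_smul_X l,
    subst_comp_subst_apply (FormalCoordChange.hasSubst_linSubst M) (h0 v)]
  congr 2
  funext i
  rw [FormalCoordChange.subst_linSubst_apply (h0 v), Matrix.mulVec, dotProduct, Finset.sum_smul]
  exact Finset.sum_congr rfl fun j _ => by rw [smul_smul]

/-! ### Polynomials not depending on the last variable -/

/-- Over an infinite field, a polynomial whose function does not depend on the last coordinate has no
monomial involving the last variable. -/
theorem coeff_eq_zero_of_eval_indep [Infinite k] {m : ℕ} (Q : MvPolynomial (Fin (m + 1)) k)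
    (hQ : ∀ v : Fin (m + 1) → k,
      MvPolynomial.eval (fun i => if i = Fin.last m then 0 else v i) Q = MvPolynomial.eval v Q)
    {E : Fin (m + 1) →₀ ℕ} (hE : E (Fin.last m) ≠ 0) : MvPolynomial.coeff E Q = 0 := by
  classical
  obtain ⟨g, hg⟩ : ∃ g : Fin (m + 1) → MvPolynomial (Fin (m + 1)) k,
      ∀ i, g i = if i = Fin.last m then 0 else MvPolynomial.X i := ⟨_, fun _ => rfl⟩
  -- `Q(x', 0) = Q` as polynomials, by `MvPolynomial.funext`
  have hH : MvPolynomial.bind₁ g Q = Q := by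
    refine MvPolynomial.funext fun v => ?_
    rw [← hQ v]
    simp only [MvPolynomial.eval, MvPolynomial.eval₂Hom_bind₁]
    have hfun : (fun i => MvPolynomial.eval₂Hom (RingHom.id k) v (g i)) =
        fun i => if i = Fin.last m then 0 else v i := by
      funext i
      rw [hg]
      split_ifs
      · exact map_zero _
      · exact MvPolynomial.eval₂Hom_X' _ _ i
    rw [hfun]
  -- `X_last` is not a variable of `Q(x', 0)`
  by_contra hne
  have hmem : Fin.last m ∈ (MvPolynomial.bind₁ g Q).vars := by
    rw [hH, MvPolynomial.mem_vars_iff_mem_support]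
    exact ⟨E, MvPolynomial.mem_support_iff.mpr hne, Finsupp.mem_support_iff.mpr hE⟩
  obtain ⟨i, -, hi⟩ := Finset.mem_biUnion.mp (MvPolynomial.vars_bind₁ g Q hmem)
  by_cases hil : i = Fin.last m
  · rw [hg, if_pos hil, MvPolynomial.vars_0] at hi
    exact Finset.notMem_empty _ hi
  · rw [hg, if_neg hil, MvPolynomial.vars_X, Finset.mem_singleton] at hi
    exact hil hi.symm

/-! ### An invertible matrix with prescribed last column -/

/-- For `c ≠ 0` there is an invertible matrix with last column `c`. -/
theorem exists_matrix_lastCol {m : ℕ} (c : Fin (m + 1) → k) (hc : c ≠ 0) :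
    ∃ M : Matrix (Fin (m + 1)) (Fin (m + 1)) k, IsUnit M.det ∧ ∀ i, M i (Fin.last m) = c i := by
  classical
  obtain ⟨l, hl⟩ := Function.ne_iff.mp hc
  obtain ⟨U, hU⟩ : ∃ U : Matrix (Fin (m + 1)) (Fin (m + 1)) k, ∀ i j,
      U i j = if j = Fin.last m then c (Equiv.swap l (Fin.last m) i) else if i = j then 1 else 0 :=
    ⟨Matrix.of fun i j => if j = Fin.last m then c (Equiv.swap l (Fin.last m) i) else if i = j then 1 else 0,
      fun _ _ => rfl⟩
  refine ⟨U.submatrix (Equiv.swap l (Fin.last m)) id, ?_, fun i => ?_⟩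
  · rw [Matrix.det_permute]
    refine IsUnit.mul ?_ ?_
    · rcases Int.units_eq_one_or (Equiv.Perm.sign (Equiv.swap l (Fin.last m))) with h | h <;> simp [h]
    · rw [← Matrix.det_transpose, TschirnhausForm.det_of_offLast_rows]
      · rw [Matrix.transpose_apply, hU, if_pos rfl, Equiv.swap_apply_right]
        exact isUnit_iff_ne_zero.mpr hl
      · intro i j hi
        rw [Matrix.transpose_apply, hU, if_neg hi]
  · rw [Matrix.submatrix_apply, id, hU, if_pos rfl, Equiv.swap_apply_self]

/-- Cancelling an invertible matrix: `M v = 0 ⇒ v = 0`. -/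
theorem eq_zero_of_mulVec_eq_zero {M : Matrix (Fin N) (Fin N) k} (hM : IsUnit M.det) {v : Fin N → k}
    (hv : M.mulVec v = 0) : v = 0 := by
  rw [← Matrix.one_mulVec v, ← Matrix.nonsing_inv_mul M hM, ← Matrix.mulVec_mulVec, hv, Matrix.mulVec_zero]

/-- An invertible matrix is onto: `v = M (M⁻¹ v)`. -/
theorem mulVec_nonsing_inv_mulVec {M : Matrix (Fin N) (Fin N) k} (hM : IsUnit M.det) (v : Fin N → k) :
    M.mulVec (M⁻¹.mulVec v) = v := by
  rw [Matrix.mulVec_mulVec, Matrix.mul_nonsing_inv M hM, Matrix.one_mulVec]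

/-- Splitting a vector along the last coordinate: `w = (w', 0) + w_z • e_z`. -/
theorem eq_snoc_init_add_smul {m : ℕ} (w : Fin (m + 1) → k) :
    w = (Fin.snoc (Fin.init w) 0 : Fin (m + 1) → k) + w (Fin.last m) • Pi.single (Fin.last m) 1 := by
  funext i
  rcases Fin.eq_castSucc_or_eq_last i with ⟨j, rfl⟩ | rfl
  · rw [Pi.add_apply, Pi.smul_apply, Fin.snoc_castSucc, Pi.single_eq_of_ne (Fin.castSucc_lt_last j).ne,
      smul_zero, add_zero, Fin.init_def]
  · rw [Pi.add_apply, Pi.smul_apply, Fin.snoc_last, Pi.single_eq_same, smul_eq_mul, mul_one, zero_add]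

end AxisNormalize

open AxisNormalize in
/-- B5 — AXIS NORMALISATION (linear algebra; `k` algebraically closed, hence infinite).  If the tangent cone of `f` (order
`d ≥ 3`, `N = n + 3` variables) has a non-zero translation-invariance vector and all its invariance vectors are collinear, then
after an invertible LINEAR change `θ` (last column the invariance vector) `f∘θ` has order `d`, its degree-`d` part involves no `z`
(`AxisCone`: a polynomial invariant under all translations in `z` has no `z`, `k` infinite; `initEval (f∘θ) v = initEval f (M v)`),
and trivial apex inside `z = 0` (`TrivialApexX`: an invariance vector `(u', 0)` of `f∘θ` gives the invariance vector `M(u',0)` of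
`f`, collinear with `M e_z`, so `u' = 0`). -/
theorem stub_axisNormalize : ∀ (k : Type) [Field k] [IsAlgClosed k] (n : ℕ) (f : MvPowerSeries (Fin (n + 3)) k),
    CobordantGame.IsSingular k f → ∀ (d : ℕ), f.order = d → 2 < d →
    (∃ c : Fin (n + 3) → k, c ≠ 0 ∧ ∀ v : Fin (n + 3) → k,
      CobordantChart.initEval (fun _ : Fin (n + 3) => 1) (v + c) d f =
        CobordantChart.initEval (fun _ : Fin (n + 3) => 1) v d f) →
    (∀ c₁ c₂ : Fin (n + 3) → k,
      (∀ v : Fin (n + 3) → k, CobordantChart.initEval (fun _ : Fin (n + 3) => 1) (v + c₁) d f =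
        CobordantChart.initEval (fun _ : Fin (n + 3) => 1) v d f) →
      (∀ v : Fin (n + 3) → k, CobordantChart.initEval (fun _ : Fin (n + 3) => 1) (v + c₂) d f =
        CobordantChart.initEval (fun _ : Fin (n + 3) => 1) v d f) →
      ∃ α β : k, (α ≠ 0 ∨ β ≠ 0) ∧ α • c₁ + β • c₂ = 0) →
    ∃ θ : Fin (n + 3) → MvPowerSeries (Fin (n + 3)) k, (∀ i, MvPowerSeries.constantCoeff (θ i) = 0) ∧
      IsUnit (Matrix.det (Matrix.of fun i j => MvPowerSeries.coeff (Finsupp.single j 1) (θ i))) ∧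
      (MvPowerSeries.subst θ f).order = d ∧
      AxisPolyhedron.AxisCone d (MvPowerSeries.subst θ f) ∧
      AxisPolyhedron.TrivialApexX d (MvPowerSeries.subst θ f) := by
  intro k _ _ n f _ d hfd _ hone hcol
  classical
  obtain ⟨c, hc0, hc⟩ := hone
  -- (1) the matrix: invertible, last column `c`
  obtain ⟨M, hMdet, hMc⟩ := exists_matrix_lastCol c hc0
  have hMe : M.mulVec (Pi.single (Fin.last (n + 2)) 1) = c := by
    rw [Matrix.mulVec_single_one]
    funext i
    rw [Matrix.col_apply, hMc]
  set θ := FormalCoordChange.linSubst M with hθ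
  set g := MvPowerSeries.subst θ f with hg
  -- (2) + (3): the degree-`d` form `Q` of `g = f ∘ θ` is `P ∘ M`, invariant under all translations along `e_z`
  have hQ : ∀ v : Fin (n + 3) → k, CobordantChart.initEval (fun _ : Fin (n + 3) => 1) v d g =
      CobordantChart.initEval (fun _ : Fin (n + 3) => 1) (M.mulVec v) d f := fun v =>
    initEval_subst_linSubst 0 M v d f
  have hQz : ∀ (v : Fin (n + 3) → k) (t : k),
      CobordantChart.initEval (fun _ : Fin (n + 3) => 1) (v + t • Pi.single (Fin.last (n + 2)) 1) d g =
        CobordantChart.initEval (fun _ : Fin (n + 3) => 1) v d g := by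
    intro v t
    rw [hQ, hQ, Matrix.mulVec_add, Matrix.mulVec_smul, hMe, initEval_add_smul hc]
  refine ⟨θ, ConeDichotomy.constantCoeff_linSubst M, ?_, ?_, ?_, ?_⟩
  · -- invertible linear part
    rw [hθ, ConeDichotomy.linMat_linSubst]
    exact hMdet
  · -- (6) the order is unchanged: `θ` is invertible
    refine le_antisymm ?_ (ConeDichotomy.le_order_subst_of_le θ (ConeDichotomy.constantCoeff_linSubst M) f _ hfd.symm.le)
    have h := ApexFreeOrderDrop.order_le_order_subst (ConeDichotomy.constantCoeff_linSubst M⁻¹) g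
    rwa [hg, hθ, FormalCoordChange.subst_linSubst_linSubst, Matrix.mul_nonsing_inv M hMdet,
      FormalCoordChange.linSubst_one, MvPowerSeries.subst_self, id_eq, hfd] at h
  · -- (4) AXIS CONE: the initial form of `g` does not depend on `z`
    intro E hEd hEz
    have hmem : E ∈ (Finset.univ : Finset (Fin (n + 3))).finsuppAntidiag d := by
      rw [ApexFreeOrderDrop.mem_antidiag_iff, ApexFreeOrderDrop.weight_one_eq_degree, hEd]
    have h := coeff_eq_zero_of_eval_indep
      (∑ e ∈ (Finset.univ : Finset (Fin (n + 3))).finsuppAntidiag d,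
        MvPolynomial.monomial e (MvPowerSeries.coeff e g)) (fun v => ?_) hEz
    · rwa [ApexFreeOrderDrop.coeff_initForm, if_pos hmem] at h
    · rw [ApexFreeOrderDrop.eval_initForm, ApexFreeOrderDrop.eval_initForm]
      conv_rhs => rw [eq_snoc_init_add_smul v, hQz]
      congr 1
      funext i
      rcases Fin.eq_castSucc_or_eq_last i with ⟨j, rfl⟩ | rfl
      · rw [if_neg (Fin.castSucc_lt_last j).ne, Fin.snoc_castSucc, Fin.init_def]
      · rw [if_pos rfl, Fin.snoc_last]
  · -- (5) TRIVIAL APEX inside `z = 0`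
    intro u hu
    by_contra hall
    push Not at hall
    apply hu
    -- `ũ = (u, 0)` is an invariance vector of `Q` everywhere
    have h1 : ∀ w : Fin (n + 3) → k,
        CobordantChart.initEval (fun _ : Fin (n + 3) => 1) (w + Fin.snoc u 0) d g =
          CobordantChart.initEval (fun _ : Fin (n + 3) => 1) w d g := by
      intro w
      rw [eq_snoc_init_add_smul w, add_right_comm, hQz, hQz, hall]
    -- `M ũ` is an invariance vector of `P`
    have h2 : ∀ v : Fin (n + 3) → k,
        CobordantChart.initEval (fun _ : Fin (n + 3) => 1) (v + M.mulVec (Fin.snoc u 0)) d f =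
          CobordantChart.initEval (fun _ : Fin (n + 3) => 1) v d f := by
      intro v
      rw [← mulVec_nonsing_inv_mulVec hMdet v, ← Matrix.mulVec_add, ← hQ, ← hQ, h1]
    -- collinearity with `c = M e_z`, cancel `M`
    obtain ⟨α, β, hαβ, hlin⟩ := hcol c (M.mulVec (Fin.snoc u 0)) hc h2
    have h3 : α • (Pi.single (Fin.last (n + 2)) 1 : Fin (n + 3) → k) + β • Fin.snoc u 0 = 0 := by
      refine eq_zero_of_mulVec_eq_zero hMdet ?_
      rw [Matrix.mulVec_add, Matrix.mulVec_smul, Matrix.mulVec_smul, hMe, hlin]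
    have hα : α = 0 := by
      have h := congr_fun h3 (Fin.last (n + 2))
      rwa [Pi.add_apply, Pi.smul_apply, Pi.smul_apply, Pi.single_eq_same, Fin.snoc_last, smul_zero, add_zero,
        smul_eq_mul, mul_one] at h
    have hβ : β ≠ 0 := hαβ.resolve_left (not_not.mpr hα)
    funext j
    have h := congr_fun h3 (Fin.castSucc j)
    rw [Pi.add_apply, Pi.smul_apply, Pi.smul_apply, Pi.single_eq_of_ne (Fin.castSucc_lt_last j).ne, Fin.snoc_castSucc,
      smul_zero, zero_add, smul_eq_mul] at h
    exact (mul_eq_zero.mp h).resolve_left hβ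

end Summit.ResolutionOfSingularities.ResolutionOfSingularities.Theorems
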